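import Summits.BirchSwinnertonDyer.BirchSwinnertonDyer.Theorems.KolyvaginDepthDoorMSymbolCert1147a1CertB
import Summits.BirchSwinnertonDyer.BirchSwinnertonDyer.Theorems.KolyvaginDepthDoorMSymbolCert1147a1Pool0
import Summits.BirchSwinnertonDyer.BirchSwinnertonDyer.Theorems.KolyvaginDepthDoorMSymbolCert1147a1Pool1
import Summits.BirchSwinnertonDyer.BirchSwinnertonDyer.Theorems.KolyvaginDepthDoorMSymbolCert1147a1Core0
import Summits.BirchSwinnertonDyer.BirchSwinnertonDyer.Theorems.KolyvaginDepthDoorMSymbolCert1147a1Core1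
import Summits.BirchSwinnertonDyer.BirchSwinnertonDyer.Theorems.KolyvaginDepthDoorMSymbolCert1147a1Inv0
import Summits.BirchSwinnertonDyer.BirchSwinnertonDyer.Theorems.KolyvaginDepthDoorMSymbolCert1147a1Inv1
import Summits.BirchSwinnertonDyer.BirchSwinnertonDyer.Theorems.KolyvaginDepthDoorMSymbolCert1147a1Inv2
import Summits.BirchSwinnertonDyer.BirchSwinnertonDyer.Theorems.KolyvaginDepthDoorMSymbolCert1147a1Inv3
import HarnessLib

/-!
# Route `KolyvaginDepthDoor`, crux `KolyvaginDepthSupplyKN` (stmt-BirchSwinnertonDyer-22820) —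
# DEPTH TABLE v30, DATA of `1147a1`, part 3: the pool part and the assembled check `cert1147a1_check`

Helper file of the lead prover of line `levelone` (kdd-p1 g35; `--supports stmt-BirchSwinnertonDyer-22820 --as helper`);
MACHINE-WRITTEN DATA + `decide` (generator `work/py/genq_lean.py`, kit 1′ `…MSymbolCertCosetsC`). The ASSEMBLED check of `…MSymbolCert1147a1` (pool part in `…Pool0/1`; `partPool`) and the assembled `checkF` (kits 2c–2e `checkF_of_parts`). It closes nothing and BSD is NOT proved by it.

References: [CremonaAlgorithms1997] §2.2–2.5, §2.8, Table 1 (1147a1); [PopaZagier2017] §4 (13); [Kim2022StructureSelmer] §1.4.3;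
[MazurTateTeitelbaum1986Invent] §I.8.
-/

set_option linter.dupNamespace false
-- the packed numerals are long literals
set_option linter.style.longLine false

noncomputable section

open scoped MatrixGroups ModularForm
open CongruenceSubgroup
open Literature.NumberTheory.EllipticCurves Literature.NumberTheory.EllipticCurves.ModularForms
open Literature.NumberTheory.Automorphic.PopaZagier (coeff12 coeff12M coeff coeffN)
open Summit.BirchSwinnertonDyer.BirchSwinnertonDyer.Rank2Observatory
open Summit.BirchSwinnertonDyer.BirchSwinnertonDyer.Rank1Residual (IntModel.frobeniusTrace_eq IntModel.minimalDiscriminantInt_eq)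
open Summit.BirchSwinnertonDyer.BirchSwinnertonDyer.Theorems.KolyvaginDepthDoor.MSymbolCert.Cert389a1
  (H3 H3fin support_subset_H3fin H3fin_det H3mat_nodup H3_det H3_coeff eval_map eval_append)

namespace Summit.BirchSwinnertonDyer.BirchSwinnertonDyer.Theorems.KolyvaginDepthDoor.MSymbolCert.Cert1147a1

/-! ## §1 Part 3 of the check; the check -/

set_option maxHeartbeats 4000000 in
/-- **The check**: `φ` satisfies the pool (`cert1147a1_poolRows0/1` of `…Pool0/…Pool1`) — with parts 1 (`…CertB`), 2a (`…Core0‥`), 2b (`…Inv0‥`)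
the certificate checks (kits 2c–2e `checkF_of_parts`). [folklore] -/
theorem cert1147a1_check : cert1147a1.checkF gen1147a1 6080 1216 phi1147a1 = true := by
  have hpool : cert1147a1.partPool gen1147a1 6080 phi1147a1 = true :=
    cert1147a1.partPool_of_forall _ _ _ (fun k hk => by
      by_cases c0 : k < 3750
      · exact cert1147a1_poolRows0 k (by omega) c0
      exact cert1147a1_poolRows1 k (by omega) (by omega)) (by decide +kernel)
  have hcore : cert1147a1.partCore gen1147a1 = true :=
    cert1147a1.partCore_of_forall _ (fun k hk => by
      have hm1 : cert1147a1.m - 1 = 106 := rfl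
      by_cases c0 : k < 53
      · exact cert1147a1_coreRows0 k (by omega) c0
      exact cert1147a1_coreRows1 k (by omega) (by omega))
  have hinv : cert1147a1.partInv = true :=
    cert1147a1.partInv_of_forall (fun k hk => by
      have hm1 : cert1147a1.m - 1 = 106 := rfl
      by_cases c0 : k < 27
      · exact cert1147a1_invRows0 k (by omega) c0
      by_cases c1 : k < 54
      · exact cert1147a1_invRows1 k (by omega) c1
      by_cases c2 : k < 80
      · exact cert1147a1_invRows2 k (by omega) c2
      exact cert1147a1_invRows3 k (by omega) (by omega))
  exact cert1147a1.checkF_of_parts _ _ _ _ cert1147a1_partPeel hcore hinv hpool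

end Summit.BirchSwinnertonDyer.BirchSwinnertonDyer.Theorems.KolyvaginDepthDoor.MSymbolCert.Cert1147a1

end
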